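import Summits.ABC.IUTFork.Cor312ThetaSideEqualM
import HarnessLib

/-!
# [IUTchIII] Corollary 3.12 at the M-LEVEL sharp setting — the local Θ-volume EQUALS the content-hull sum for EVERY family of
# nonzero Θ-ideles (not only the datum's read-off ideles): `−|log(Θ)|_{i+1,u} = Σ_{v⃗} Pr(v⃗)·log μ̄_{v⃗}(hull(p^{m(v⃗)}·log_p(R_{v⃗}^×)))`

PROOF-ONLY file (D-0012; no definitions, no `Prop` facts) of the abc-iut cell (R2 S-chain seat abc-iut-s2-p9, gen 0; branch C
«abc ⇐ S»). TAKES NO SIDE on [IUTchIII] Cor. 3.12. `Cor312ThetaSideEqualM` (p448956) pins the local Θ-volume of the M-level sharp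
setting of the datum's OWN Θ-ideles `tOfIdeleData D r` to the orbit sum; THIS file records the same EQUALITY for an ARBITRARY family
`t` of nonzero Θ-ideles, units off a finite set (the shape «for every realising choice» of the K-level line, abc-iut-s2-p6), against
the EXACT content family `m` of the slot unions `⋃_a ι_a(t_{u,i,v̲_a})·(R_I)^∼` (abc-iut-w5-d180 `exists_content`; exact families are
capsule-symmetric, abc-iut-s2-p7 `content_slotUnion_perm`): abc-iut-s2-p7's content-hull bound (P6-instA, `≤`) and this seat's reverse
inequality (`Cor312Vol.sum_content_hull_le_thetaLocal_untopD`, p448133; `hism` by `exists_indGroup_comparison_eq_congr_presAtM`, `hwit` by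
`exists_mem_sUnion_possibleImages_exact_content_of_ideles` below).

* `exists_mem_sUnion_possibleImages_exact_content_of_ideles`, **`thetaLocal_settingPrVolSharpM_eq_coe_sum_content`**,
  `thetaLocal_settingMSharp_eq_coe_sum_content`.

[cite: Mochizuki2012, IUTchIII Thm. 3.11 (i) (Ind1), (Ind2) p. 154] [cite: Mochizuki2012, IUTchIV Thm. 1.10 Step (v) p. 27–28]
[cite: DupuyHilado2025, §4.7, §4.9, §4.12] [claim: Mochizuki2012, status: disputed] for the quoted setting.
HONEST FRAMING: identities between TYPED objects; nothing asserted or denied about Cor. 3.12; typed ≠ proved; instantiated ≠ endorsed.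
-/

noncomputable section

open Set Function NumberField IsDedekindDomain
open scoped Pointwise

namespace Summit.ABC.IUTFork.Thm311.Real

open Cor312 Cor312Vol Literature.IUT.LogThetaLattice Literature.IUT.LogVolume Literature.IUT.HodgeTheaters
  Literature.NumberTheory.NumberFields

variable {F K Fbar : Type} [Field F] [NumberField F] [Field K] [NumberField K] [Algebra F K]
  [Field Fbar] [Algebra F Fbar] [Algebra K Fbar] {E : WeierstrassCurve F} [E.IsElliptic] {l : ℕ}
  {Pb : BadPlacePredicates K} (D : InitialThetaData F K Fbar E l Pb) {logvK : PadicLogsVal K}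
  (hlog : LogvAnalyticVal logvK) (r : ThetaData.IdeleData D)
  (tq : ∀ (u : FinitePlace ℚ) (x : (thetaIndexOfInitial D).Fibre (Val.non u)),
    kOfM D (ratChar u) u (natCast_ratChar_mem u) x)
  (M : Type) [Field M] [NumberField M]
  (archPk : ∀ (j : (thetaIndexOfInitial D).Label) (vQ : (thetaIndexOfInitial D).VQ),
    Set ((logShellsOfInitialDH D logvK).Packet j vQ))
  (archSub : ∀ (j : (thetaIndexOfInitial D).Label) (v : (thetaIndexOfInitial D).V),
    Set ((logShellsOfInitialDH D logvK).Packet j ((thetaIndexOfInitial D).over v)))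
  (Ψ : ℤ → ∀ v : (thetaIndexOfInitial D).V, v ∈ (thetaIndexOfInitial D).Vbad →
    Set ((logShellsOfInitialDH D logvK).StarPacket v))
  (act : ℤ → ∀ v : (thetaIndexOfInitial D).V, v ∈ (thetaIndexOfInitial D).Vbad →
    (logShellsOfInitialDH D logvK).StarPacket v → Module.End ℚ ((logShellsOfInitialDH D logvK).StarPacket v))
  (Mmod : ℤ → ∀ j : (thetaIndexOfInitial D).LabelStar, Set ((logShellsOfInitialDH D logvK).GlobalPacket j.1))
  (region : ℤ → ∀ j : (thetaIndexOfInitial D).LabelStar, FinDivisor M → ∀ vQ : (thetaIndexOfInitial D).VQ,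
    Set ((logShellsOfInitialDH D logvK).Packet j.1 vQ))
  (n : ℤ) {HT : Type} {LogLink : HT → HT → Type} {IsFull : ∀ {s t : HT}, LogLink s t → Prop}
  (lat : LGPGaussianLogThetaLattice LogLink IsFull)
  {Frd : Type} {IsoF : Frd → Frd → Type} {Ob : Frd → Type} {realify : Frd → Frd} {Strip : Type}
  {IsoS : Strip → Strip → Type}
  {Mv : ∀ v : (thetaIndexOfInitial D).V, v ∈ (thetaIndexOfInitial D).Vbad → Type} [∀ v h, Monoid (Mv v h)]
  (sig : GlobalLGPFrobenioidSignature (thetaIndexOfInitial D).lstar (thetaIndexOfInitial D).V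
    (· ∈ (thetaIndexOfInitial D).Vbad) Frd IsoF Ob realify Strip IsoS Mv)
  (split : SplittingMonoids Mv) {ObΔ : Type}
  {N : ∀ v : (thetaIndexOfInitial D).V, v ∈ (thetaIndexOfInitial D).Vbad → Type} [∀ v h, Monoid (N v h)]
  (qData : QPilotData ObΔ N)
  (htq0 : ∀ u x, tq u x ≠ 0) (Sq : Finset (FinitePlace ℚ))
  (htq1 : ∀ (u : FinitePlace ℚ) (x : (thetaIndexOfInitial D).Fibre (Val.non u)), u ∉ Sq → ‖tq u x‖ = 1)

  (t : ∀ (u : FinitePlace ℚ) (_ : Fin (thetaIndexOfInitial D).lstar) (x : (thetaIndexOfInitial D).Fibre (Val.non u)),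
    kOfM D (ratChar u) u (natCast_ratChar_mem u) x)

/-- **`hwit` for arbitrary Θ-ideles**: every summand `v⃗` at `(i+1, u)` carries, in the union of the possible images of the sharp setting
with Θ-ideles `t`, a vector of content EXACTLY `p_u^{m(v⃗)}` for any exact content exponent `m(v⃗)` of the slot union — the exact-content
vector lies in some slot `a`, i.e. in the (Ind1)-image `perm_σ(sharpBox_{v⃗∘σ})`, `σ = (last a)` (abc-iut-S8
`image_permAlgEquiv_iota_smul_normalizedPacket`; this seat's `Cor312Vol.exists_mem_sUnion_possibleImages_comparison_eq_permX`).
[cite: Mochizuki2012, IUTchIII Thm. 3.11 (i) (Ind1) p. 154] [cite: DupuyHilado2025, §4.7, §4.12] -/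
theorem exists_mem_sUnion_possibleImages_exact_content_of_ideles (i : Fin (thetaIndexOfInitial D).lstar) (u : FinitePlace ℚ)
    (m : ((thetaIndexOfInitial D).Caps (Setting.labelSucc i) → (thetaIndexOfInitial D).Fibre (Val.non u)) → ℤ)
    (e : (thetaIndexOfInitial D).Caps (Setting.labelSucc i) → (thetaIndexOfInitial D).Fibre (Val.non u))
    (hm0 : (⋃ a, iota (ratChar u) ((presAtM D hlog u).kk e) a (t u i (e a)) •
        (normalizedPacket (ratChar u) ((presAtM D hlog u).kk e) : Set ((presAtM D hlog u).X e))) ⊆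
      (((ratChar u : ℕ) : ℚ_[ratChar u]) ^ m e) • (logPacket (ratChar u) ((presAtM D hlog u).kk e) : Set ((presAtM D hlog u).X e)))
    (hm1 : ¬ (⋃ a, iota (ratChar u) ((presAtM D hlog u).kk e) a (t u i (e a)) •
        (normalizedPacket (ratChar u) ((presAtM D hlog u).kk e) : Set ((presAtM D hlog u).X e))) ⊆
      (((ratChar u : ℕ) : ℚ_[ratChar u]) ^ (m e + 1)) •
        (logPacket (ratChar u) ((presAtM D hlog u).kk e) : Set ((presAtM D hlog u).X e))) :
    ∃ x ∈ ⋃₀ (settingPrVolSharpM D hlog t tq M archPk archSub Ψ act Mmod region n lat sig split qData htq0 Sq htq1).possibleImages (Setting.labelSucc i) (Val.non u),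
      (presAtM D hlog u).comparison (Setting.labelSucc i) x e ∈
          (((ratChar u : ℕ) : ℚ_[ratChar u]) ^ m e) •
            (logPacket (ratChar u) ((presAtM D hlog u).kk e) : Set ((presAtM D hlog u).X e)) ∧
        (presAtM D hlog u).comparison (Setting.labelSucc i) x e ∉
          (((ratChar u : ℕ) : ℚ_[ratChar u]) ^ (m e + 1)) •
            (logPacket (ratChar u) ((presAtM D hlog u).kk e) : Set ((presAtM D hlog u).X e)) := by
  classical
  obtain ⟨y, hyU, hy1⟩ := Set.not_subset.mp hm1
  have hy0 := hm0 hyU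
  obtain ⟨a, hya⟩ := Set.mem_iUnion.mp hyU
  obtain ⟨σ, rfl⟩ : ∃ σ : Equiv.Perm ((thetaIndexOfInitial D).Caps (Setting.labelSucc i)), σ (Fin.last _) = a :=
    ⟨Equiv.swap (Fin.last _) a, Equiv.swap_apply_left _ _⟩
  have hbox : ⇑(permAlgEquiv (ratChar u) ((presAtM D hlog u).kk e) σ) ''
      (presAtM D hlog u).sharpBox (t u) (Setting.labelSucc i) (e ∘ σ) =
      iota (ratChar u) ((presAtM D hlog u).kk e) (σ (Fin.last _)) (t u i (e (σ (Fin.last _)))) •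
        (normalizedPacket (ratChar u) ((presAtM D hlog u).kk e) : Set ((presAtM D hlog u).X e)) := by
    rw [PadicPresentation.sharpBox, PadicPresentation.labelIdele_labelSucc]
    exact image_permAlgEquiv_iota_smul_normalizedPacket (ratChar u) ((presAtM D hlog u).kk e) σ (Fin.last _) _
  rw [← hbox] at hya
  obtain ⟨z, hz, hzy⟩ := hya
  have hB0 : ∀ e', (0 : (presAtM D hlog u).X e') ∈ (presAtM D hlog u).sharpBox (t u) (Setting.labelSucc i) e' :=
    fun e' => Set.mem_smul_set.mpr ⟨0, Subring.zero_mem _, smul_zero _⟩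
  obtain ⟨x, hxU, hx⟩ := exists_mem_sUnion_possibleImages_comparison_eq_permX
    (P := settingPrVolSharpM D hlog t tq M archPk archSub Ψ act Mmod region n lat sig split qData htq0 Sq htq1)
    (presAtM D hlog u) (Setting.labelSucc i) ((presAtM D hlog u).sharpBox (t u) (Setting.labelSucc i))
    (subset_of_eq (thetaRegion3_settingPrVolSharpM_eq_preimage_pi D hlog tq M archPk archSub Ψ act Mmod region n lat sig split
      qData htq0 Sq htq1 t (Setting.labelSucc i) u).symm)
    hB0 e σ hz
  refine ⟨x, hxU, ?_⟩
  have hxy : (presAtM D hlog u).comparison (Setting.labelSucc i) x e = y := hx.trans hzy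
  rw [hxy]
  exact ⟨hy0, hy1⟩

/-- **THE LOCAL Θ-VOLUME IS THE CONTENT-HULL SUM, for EVERY family of nonzero Θ-ideles that are units off a finite set**:
`−|log(Θ)|_{i+1,u} = Σ_{v⃗} weightM(v⃗)·(−m(v⃗)·log p_u + log μ̄_{v⃗}(hull(log_p(R_{v⃗}^×))))` at abc-iut-s2-p8's summand-route sharp setting,
for any EXACT content family `m` of the slot unions (exact families are capsule-symmetric, abc-iut-s2-p7 `content_slotUnion_perm`):
`≤` is abc-iut-s2-p7's P6-instA `thetaLocal_settingPrVolSharpM_le_coe_sum_content`, `≥` this seat's `Cor312Vol.sum_content_hull_le_thetaLocal_untopD`.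
[cite: Mochizuki2012, IUTchIV Thm. 1.10 Step (v) p. 27–28] [cite: DupuyHilado2025, §4.9, §4.12] -/
theorem thetaLocal_settingPrVolSharpM_eq_coe_sum_content (ht0 : ∀ u i x, t u i x ≠ 0) (Sθ : Finset (FinitePlace ℚ))
    (ht1 : ∀ (u : FinitePlace ℚ) (i : Fin (thetaIndexOfInitial D).lstar) (x : (thetaIndexOfInitial D).Fibre (Val.non u)),
      u ∉ Sθ → ‖t u i x‖ = 1)
    (i : Fin (thetaIndexOfInitial D).lstar) (u : FinitePlace ℚ) [Fintype ((thetaIndexOfInitial D).Fibre (Val.non u))]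
    (m : ((thetaIndexOfInitial D).Caps (Setting.labelSucc i) → (thetaIndexOfInitial D).Fibre (Val.non u)) → ℤ)
    (hm : ∀ e : (thetaIndexOfInitial D).Caps (Setting.labelSucc i) → (thetaIndexOfInitial D).Fibre (Val.non u),
      (⋃ a, iota (ratChar u) ((presAtM D hlog u).kk e) a (t u i (e a)) •
          (normalizedPacket (ratChar u) ((presAtM D hlog u).kk e) : Set ((presAtM D hlog u).X e))) ⊆
        (((ratChar u : ℕ) : ℚ_[ratChar u]) ^ m e) •
          (logPacket (ratChar u) ((presAtM D hlog u).kk e) : Set ((presAtM D hlog u).X e)) ∧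
      ¬ (⋃ a, iota (ratChar u) ((presAtM D hlog u).kk e) a (t u i (e a)) •
          (normalizedPacket (ratChar u) ((presAtM D hlog u).kk e) : Set ((presAtM D hlog u).X e))) ⊆
        (((ratChar u : ℕ) : ℚ_[ratChar u]) ^ (m e + 1)) •
          (logPacket (ratChar u) ((presAtM D hlog u).kk e) : Set ((presAtM D hlog u).X e))) :
    (settingPrVolSharpM D hlog t tq M archPk archSub Ψ act Mmod region n lat sig split qData htq0 Sq htq1).thetaLocal (Setting.labelSucc i) (Val.non u) =
      ((∑ e : (thetaIndexOfInitial D).Caps (Setting.labelSucc i) → (thetaIndexOfInitial D).Fibre (Val.non u),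
        weightM D u (Setting.labelSucc i) e * (-(m e * Real.log (ratChar u)) +
          packetLogμ (ratChar u) ((presAtM D hlog u).kk e)
            (packetHull (ratChar u) ((presAtM D hlog u).kk e)
              (logPacket (ratChar u) ((presAtM D hlog u).kk e) : Set ((presAtM D hlog u).X e)))) : ℝ) : WithTop ℝ) := by
  classical
  letI : Fintype ((presAtM D hlog u).factorIdx (Setting.labelSucc i)) :=
    factorIdxM_fintype D hlog (Setting.labelSucc i) (Val.non u)
  -- exact content families are capsule-symmetric
  have hsymm : ∀ (σ : Equiv.Perm ((thetaIndexOfInitial D).Caps (Setting.labelSucc i)))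
      (e : (thetaIndexOfInitial D).Caps (Setting.labelSucc i) → (thetaIndexOfInitial D).Fibre (Val.non u)), m (e ∘ σ) = m e :=
    fun σ e => content_slotUnion_perm (ratChar u) ((presAtM D hlog u).kk e) σ (fun a => t u i (e a))
      (hm (e ∘ σ)).1 (hm (e ∘ σ)).2 (hm e).1 (hm e).2
  refine le_antisymm (thetaLocal_settingPrVolSharpM_le_coe_sum_content D hlog t tq M archPk archSub Ψ act Mmod region n lat sig split
    qData htq0 Sq htq1 ht0 Sθ ht1 i u m hsymm fun e => (hm e).1) ?_
  -- the reverse inequality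
  have hne : (settingPrVolSharpM D hlog t tq M archPk archSub Ψ act Mmod region n lat sig split qData htq0 Sq htq1).thetaLocal (Setting.labelSucc i) (Val.non u) ≠ ⊤ :=
    (thetaFinite_settingPrVolSharpM D hlog t tq M archPk archSub Ψ act Mmod region n lat sig split qData htq0 Sq htq1 ht0 Sθ ht1).1 i _
  have hdef : (settingPrVolSharpM D hlog t tq M archPk archSub Ψ act Mmod region n lat sig split qData htq0 Sq htq1).HullDefined (Setting.labelSucc i) (Val.non u) := by
    by_contra h
    exact hne (by rw [Cor312.Setting.thetaLocal, if_neg h])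
  have hge := sum_content_hull_le_thetaLocal_untopD
    (P := settingPrVolSharpM D hlog t tq M archPk archSub Ψ act Mmod region n lat sig split qData htq0 Sq htq1)
    (presAtM D hlog u) i hdef
    (frame_settingPrVolSharpM_non D hlog t tq M archPk archSub Ψ act Mmod region n lat sig split qData htq0 Sq htq1 _ u)
    (fun R hR => logvol_situationPrVolM_preimage_pi D hlog M archPk archSub Ψ act Mmod region n _ u R hR) m
    (fun e => exists_mem_sUnion_possibleImages_exact_content_of_ideles D hlog tq M archPk archSub Ψ act Mmod region n lat sig split
      qData htq0 Sq htq1 t i u m e (hm e).1 (hm e).2)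
    (fun e g' hg' => exists_indGroup_comparison_eq_congr_presAtM D hlog M archPk archSub Ψ act Mmod region
      (Setting.labelSucc i) u e g' hg')
  obtain ⟨c, hc⟩ := WithTop.ne_top_iff_exists.mp hne
  rw [← hc] at hge ⊢
  rw [WithTop.untopD_coe] at hge
  exact WithTop.coe_le_coe.mpr hge

/-- **… and at abc-iut-w5-d166's frames-route sharp setting `settingMSharp`** (same local terms, abc-iut-w4-d013's two-routes identity).
[cite: Mochizuki2012, IUTchIV Thm. 1.10 Step (v) p. 27–28] [cite: DupuyHilado2025, §4.9, §4.12] -/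
theorem thetaLocal_settingMSharp_eq_coe_sum_content (ht0 : ∀ u i x, t u i x ≠ 0) (Sθ : Finset (FinitePlace ℚ))
    (ht1 : ∀ (u : FinitePlace ℚ) (i : Fin (thetaIndexOfInitial D).lstar) (x : (thetaIndexOfInitial D).Fibre (Val.non u)),
      u ∉ Sθ → ‖t u i x‖ = 1)
    (i : Fin (thetaIndexOfInitial D).lstar) (u : FinitePlace ℚ) [Fintype ((thetaIndexOfInitial D).Fibre (Val.non u))]
    (m : ((thetaIndexOfInitial D).Caps (Setting.labelSucc i) → (thetaIndexOfInitial D).Fibre (Val.non u)) → ℤ)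
    (hm : ∀ e : (thetaIndexOfInitial D).Caps (Setting.labelSucc i) → (thetaIndexOfInitial D).Fibre (Val.non u),
      (⋃ a, iota (ratChar u) ((presAtM D hlog u).kk e) a (t u i (e a)) •
          (normalizedPacket (ratChar u) ((presAtM D hlog u).kk e) : Set ((presAtM D hlog u).X e))) ⊆
        (((ratChar u : ℕ) : ℚ_[ratChar u]) ^ m e) •
          (logPacket (ratChar u) ((presAtM D hlog u).kk e) : Set ((presAtM D hlog u).X e)) ∧
      ¬ (⋃ a, iota (ratChar u) ((presAtM D hlog u).kk e) a (t u i (e a)) •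
          (normalizedPacket (ratChar u) ((presAtM D hlog u).kk e) : Set ((presAtM D hlog u).X e))) ⊆
        (((ratChar u : ℕ) : ℚ_[ratChar u]) ^ (m e + 1)) •
          (logPacket (ratChar u) ((presAtM D hlog u).kk e) : Set ((presAtM D hlog u).X e))) :
    (settingMSharp D hlog M archPk archSub Ψ act Mmod region n lat sig split qData t tq htq0 Sq htq1).thetaLocal
        (Setting.labelSucc i) (Val.non u) =
      ((∑ e : (thetaIndexOfInitial D).Caps (Setting.labelSucc i) → (thetaIndexOfInitial D).Fibre (Val.non u),
        weightM D u (Setting.labelSucc i) e * (-(m e * Real.log (ratChar u)) +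
          packetLogμ (ratChar u) ((presAtM D hlog u).kk e)
            (packetHull (ratChar u) ((presAtM D hlog u).kk e)
              (logPacket (ratChar u) ((presAtM D hlog u).kk e) : Set ((presAtM D hlog u).X e)))) : ℝ) : WithTop ℝ) := by
  rw [thetaLocal_settingMSharp_eq_settingPrVolSharpM]
  exact thetaLocal_settingPrVolSharpM_eq_coe_sum_content D hlog tq M archPk archSub Ψ act Mmod region n lat sig split qData htq0 Sq
    htq1 t ht0 Sθ ht1 i u m hm

end Summit.ABC.IUTFork.Thm311.Real

end
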